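import Summits.AtomisticToContinuum.Crystallization.Theorems.ChartedZeroExcessLayeredLatticeLiouvilleYR

/-!
# Part YS «TangentResponse» (lens-2 g70): the response leaf (G∞) by TANGENT STIFFNESS + NEUMANN BOOTSTRAP, (G∞) ⟸ (Gh) ∧ (Gs)

Docket `stmt-AtomisticToContinuum-26636` (N = `…Theses.ChartedPlanarOrder.ChartedZeroExcessLayered`), cell decomp-a2c RESIDUAL MODE, lens-2
«structural dichotomy (special vs generic)», generation 70.  Node beneath the UNDECIDED · HEAVY piece (G∞) `TubeResponseP` of part YQ «FluxResponse»
v2 (g69; critic rows 1272 / 1274 (d): "then (G∞) into the harmonic response at the reference and the anharmonic drift across the tube").  Imports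
part YR (the (Res) split) for the whole-node corollaries of §YS-4.  The junction is PROVED.

## The node

  (G∞) `TubeResponseP … Rg sb dI dB Rφ C …` (C = the Neumann matrix below, or any entrywise larger one)
    ⟸ (Gh) `HarmonicResponseP … Rg sb dI dB Rφ HsG … HBB …`   [LINEAR ALGEBRA of ONE operator · ANALYTIC · HEAVY · UNDECIDED · INSTRUMENTABLE «GreenRow-T»:
                                                               class-split max-norm bound for the inverse of the TANGENT STIFFNESS `H = D²E(y₀)`, flux currency]
     ∧ (Gs) `TangentDriftP … Rg sb dI dB Rφ κg κI κb …`        [ANHARMONIC TAYLOR REMAINDER · ANALYTIC · ATTACKABLE · INSTRUMENTABLE «Drift-T»: the load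
                                                               `D E(z) − D E(y₀) − H(z − y₀)` of a tube member at gauge `λ ∈ [0, 1]` has class levels `≤ λ·κ`]
     ∧ NEUMANN ARITHMETIC: `0 ≤ qN < 1`, `(Hκ)_k ≤ qN·ρᵒ_k` (contraction of the drift through the harmonic response, per tube row `k ∈ {s, I, B}`,
       `ρᵒ = (sb, dI, dB)`), gauge weights `w_c` (`H_{k,c} ≤ w_c·ρᵒ_k`), output matrix `C_{k,c} = H_{k,c} + (Hκ)_k·w_c/(1 − qN)`   [arithmetic]
  junction `tubeResponseP_of_tangent` PROVED (both pieces and the arithmetic load-bearing; all constants symbolic).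

* `H` IS PINNED, NOT CHOSEN: (Gs) produces `∃ H, HasFDerivAt (D E) H y₀ ∧ …` and (Gh) consumes `∀ H, HasFDerivAt (D E) H y₀ → …` — the derivative of
  `z ↦ fderiv ℝ E z` at `y₀` is unique, so both speak of THE tangent stiffness; no Hessian formula is written down (nothing to get wrong), and
  the split cannot degenerate into the secant tautology (a free "stiffness selector" would contain `H := secant`, which makes (Gs) vacuous and
  (Gh) = (G∞): COSTUME — excluded by typing `H` as ONE continuous linear map fixed by `HasFDerivAt`).
* THE BOOTSTRAP (§YS-2, PROVED, scalar): in tube gauge `λ` (`z ∈ T(λρᵒ)`), a member `z` of the outer tube (`λ ≤ 1`) with response load of levels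
  `M` satisfies `H(z − y₀) = (D E(z) − D E(y₀)) − drift`, levels `≤ M + λκ` (`HasTubeFluxLoad.add/.smul`); (Gh) returns `z ∈ T(HM + λHκ) ⊆
  T((m + qN·λ)ρᵒ)` with `m := Σ_c w_c M_c`; iterating `λ ↦ m + qN·λ` from `λ = 1` and closing the tube from above gives `z ∈ T(λ̂ρᵒ)`,
  `λ̂ = min(1, m/(1 − qN))`, whence `z ∈ T(HM + λ̂·Hκ) ⊆ T(C·M)` — for EVERY `M ≥ 0` (large loads are covered by `λ̂ ≤ 1`).
* (Gs) is typed LINEAR in the gauge on `[0, 1]` (the quadratic Taylor bound `c·λ²` IMPLIES it with `κ = c`; (G∞)'s `M`-linear format has no room for the gain).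
* TEETH (PROVED): (Gh) at zero levels forces `u = 0` (`HarmonicResponseP.eq_zero`: the tangent stiffness has no floppy mode in the tube's gauge);
  with (Gs) the junction re-derives (G∞)'s rigidity `TubeResponseP.eq_reference` (part YQ).

## Lens reading (special vs generic)
SPECIAL = the harmonic crystal (ONE linear operator, the tangent stiffness at the reference; its inverse is a lattice Green's function, «GreenRow-T»);
GENERIC = anharmonicity (a Taylor remainder proportional to the tube's gauge, contracted by the Neumann series; exhaustion = FTC on `[y₀, z]`, YOA).

## Pre-registered feasibility window (census decides: «GreenRow-T» `H_{k,c}`; NEW «Drift-T» `κ` at the outer radii and `qN`; both per sampled core)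
LJ numbers (`a₀ = 0.9716`, `V″(a₀) = 10.64`, `V‴(a₀) ≈ −207`): drift per unit gauge `κ ≈ (½|V‴|·sb², ≈ 4–5 exterior bonds × ½|V‴|·dI², ≈ 10⁻³)`;
at the record outer radii `(3/400, 3/400, 3/10)`: `κ ≈ (0.006, 0.013, 0.001)`, and with the critic's Green-row forecast (`Hs_g ≈ 3`, `HI_g ≈ 1–3`,
`Hs_I ≈ HI_I ≈ 0.3`, `HB_g ≈ 10`, `HB_I ≈ 3`, `HB_b ≈ 25`) the contraction ratios are `qN ≈ (3, 2, 0.4)` — rows `s`, `I` FAIL by `×3` (bond-class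
gain × bond-class drift).  `qN ∝` outer radius: at `(1/800, 1/800, 3/10)` `qN ≈ (0.65, 0.5, 0.02)` passes, but then `inner < outer` forces the
residual budget of rows `s`/`I` to `≲ 6·10⁻⁴`, i.e. near interface level `≲ 2·10⁻³` (collar `ϑm ≲ 1/7500` against the record `1/2000`) and near
bond level `≲ 2·10⁻⁴` (an essentially REGISTERED reference).  FORECAST, not a verdict: the cut is typed with every constant symbolic.

## Reference class (finding for the g71 planner; no re-typing here)
`IsTubeReference ϑ₀ …` admits `ϑ₀`-tame but UNREGISTERED references (roughness `≈ 10.6·ϑ₀` of bond flux in (Rn); `ϑ₀ ≳ ϑc` since interface stars of an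
exact patch are only `≈ ϑc`-tame).  Every ∀-piece ((X1), (Gh), (Gs), (Rn), (Rt)) is WEAKER over GLOBALLY REGISTERED references (`∃ U g, g i ∈ H ∧
dist (U (y₀ i − y₀ j)) (g i − g j) ≤ ϑᵣ` on `Rφ`-pairs), and (XR) — part YF's frame step — constructs exactly such one: refining `IsTubeReference` and
re-gluing YO-4 is the g71 move if «RefLoad-T(near)» puts the bond level of `ϑ₀`-generic references above budget.  Why each piece might fail: see the
decl docstrings ((Gh) Green-row growth `∝ ρ` / `log ρ`, soft interface stars; (Gs) `|V‴(a₀)| ≈ 207` ⇒ `κ_s ≈ 110·sb²`, `sb ≲ 1/800`).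

## Sources
part YQ v2 ((G∞), currency); part YOA (tube, convexity); E–Ming, ARMA 183 (2007) (stability = harmonic + remainder); Ortner–Theil, ARMA 207
(2013) and Ehrlacher–Ortner–Shapeev, ARMA 222 (2016) (lattice Green's functions, inverse-function argument with Lipschitz `D²E`); Ortner–Shapeev
arXiv:1204.3705 §4; Kantorovich's Newton theorem (the scalar bootstrap); CRITIC-LEDGER rows 1250, 1272, 1274.  0 sorry; standard axioms.
-/

noncomputable section
open scoped BigOperators Classical InnerProductSpace RealInnerProductSpace
open MeasureTheory Set Metric Filter Topology
open Summit.AtomisticToContinuum.Crystallization.Theorems.ChartedPlanarOrderRigidityDoor (E3 eStar atomsIn IsEStarGSC siteEnergy VisibleGap PertRegime)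
open Summit.AtomisticToContinuum.Crystallization.Theorems.ChartedPlanarOrderDensityDichotomy (μS IsSep nK nK_nonneg)
open Summit.AtomisticToContinuum.Crystallization.Theorems.ChartedPlanarOrderCleanScaleP (IsCleanP IsDoorSetP)
open Summit.AtomisticToContinuum.Crystallization.Theorems.ChartedPlanarOrderMesoCut (LayeredHom EnvClose)
open Summit.AtomisticToContinuum.Crystallization.Theorems.ChartedPlanarOrderDoorLayered (atomsIn_subset sq_le_finsum_mem PeriodicBulkGapDoor)
open Summit.AtomisticToContinuum.Crystallization.Theorems.ChartedPlanarOrderDoorLayeredOsc (IsTwoShellAffineGood)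
open Literature.MathematicalPhysics.StatisticalMechanics (card_le_of_separated_of_dist_le lennardJones interactionEnergy)

namespace Summit.AtomisticToContinuum.Crystallization.Theorems.ChartedZeroExcessLayeredLatticeLiouville

/-! ### YS-1  The two pieces (Gh) / (Gs) (typed; binders of (G∞) verbatim; matrix, drift levels and flux radius symbolic) -/

section TangentResponse

/-- ★★★ **(Gh) «HarmonicResponseP … Rg sb dI dB Rφ HsG HsI HsB HIG HII HIB HBG HBI HBB …» — CLASS-SPLIT MAX-NORM RESPONSE OF THE TANGENT STIFFNESS AT
THE REFERENCE.**  Under the binders of (G∞) verbatim, for every tube reference `y₀` and THE tangent stiffness `H` of the clamped energy at `y₀`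
(`HasFDerivAt (z ↦ fderiv ℝ E z) H y₀`, `E = clampedEnergy (S ∖ core)`): for every displacement `u` whose harmonic load `H u` has class levels
`(Mg, MI, Mb) ≥ 0` about `y₀` (flux radius `Rφ`), `y₀ + u` lies in the response tube `bondTube (S ∖ core) Rg (Σ_c Hs_c M_c) (Σ_c HI_c M_c) (Σ_c HB_c M_c) y₀`.
ONE linear operator: the bound `‖u‖_k ≤ Σ_c H_{k,c}·‖Hu‖_c` for the inverse of the clamped lattice patch's stiffness in divergence-form currency —
the sharp `H_{k,c}` are the class-wise `ℓ¹` row sums of its Green's function («GreenRow-T»: one sparse factorisation per sampled core).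
ANALYTIC · HEAVY · UNDECIDED · WEAKER than (G∞) (one operator instead of the tube's secant class).  At zero levels: NO FLOPPY MODE (`.eq_zero`).
Why it might fail: bond-class rows grow with the core radius (`H_{·,g} ∝ ρ` at fixed `Rφ`), interface dipole rows `∝ log ρ`; soft under-coordinated
interface stars of the collar.
Sources: part YQ (G∞); E–Ming 2007; Ortner–Theil 2013; Ehrlacher–Ortner–Shapeev 2016; CRITIC-LEDGER rows 1272 (B)/(D), 1274 (d). [this file, g70] -/
def HarmonicResponseP (ϑc ϑ ϑp r q rsh ρ rm dm ϑ₀ Rg sb dI dB Rφ HsG HsI HsB HIG HII HIB HBG HBI HBB aHi Λ θ s : ℝ) : Prop :=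
  ∀ δ : ℝ, 0 < δ → ∀ a : ℝ, 0 < a →
    ∀ S : Set E3, IsDoorSetP aHi δ S → (∀ z : E3, Summable fun y : S => lennardJones (dist z (y : E3))) →
      (∀ p ∈ S, IsTwoShellAffineGood θ S p) →
        ∀ (L : E3 ≃L[ℝ] E3) (w : ℤ → E3), IsEquilChart a s Λ L w →
          ∀ (x₀ : E3) (K : Set E3), K ⊆ S → (∀ k ∈ K, dist k x₀ ≤ q) →
            IsTameOn ϑp S (LayeredHom (L : E3 →L[ℝ] E3) w) (coreOf S K rm) →
              IsTameOn ϑc S (LayeredHom (L : E3 →L[ℝ] E3) w) (moatIn S K r (r + rsh)) →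
                ∀ (n : ℕ) (xf : Fin n → E3), Function.Injective xf → Set.range xf = coreOf S K ρ →
                  ∀ y₀ : Fin n → E3, IsTubeReference ϑ₀ ϑ dm Rg sb dI dB (S \ coreOf S K ρ) (LayeredHom (L : E3 →L[ℝ] E3) w) xf y₀ →
                    ∀ H : (Fin n → E3) →L[ℝ] ((Fin n → E3) →L[ℝ] ℝ),
                      HasFDerivAt (fun z : Fin n → E3 => fderiv ℝ (fun z : Fin n → E3 => clampedEnergy (S \ coreOf S K ρ) z) z) H y₀ →
                        ∀ u : Fin n → E3, ∀ Mg MI Mb : ℝ, 0 ≤ Mg → 0 ≤ MI → 0 ≤ Mb →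
                          HasTubeFluxLoad (S \ coreOf S K ρ) Rg Rφ Mg MI Mb y₀ (H u) →
                            y₀ + u ∈ bondTube (S \ coreOf S K ρ) Rg (HsG * Mg + HsI * MI + HsB * Mb) (HIG * Mg + HII * MI + HIB * Mb)
                              (HBG * Mg + HBI * MI + HBB * Mb) y₀

/-- ★★ **(Gs) «TangentDriftP … Rg sb dI dB Rφ κg κI κb …» — THE ANHARMONIC DRIFT ACROSS THE TUBE IS GAUGE-SMALL IN FLUX CURRENCY.**  Under the binders
of (G∞) verbatim, for every tube reference `y₀` with residual `φ₀ = D E(y₀)`: the map `z ↦ fderiv ℝ E z` is differentiable at `y₀` with some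
derivative `H` (the tangent stiffness), and for every member `z` of the outer tube with `D E(z) = φ` that lies in the SCALED tube
`bondTube (S ∖ core) Rg (λ·sb) (λ·dI) (λ·dB) y₀`, `0 ≤ λ ≤ 1`, the TAYLOR REMAINDER LOAD `φ − φ₀ − H(z − y₀)` has class levels `(λ·κg, λ·κI, λ·κb)`.
The true remainder is quadratic in the gauge (`½·sup|D³E|`); linear on `[0, 1]` is the weaker statement (G∞)'s format can use.  Site forces of the
remainder are sums over the `4`-stars of third differences of `V` — bond-flux class for core–core pairs, interface class for exterior bonds.
ANALYTIC · ATTACKABLE · WEAKER than (G∞) · INSTRUMENTABLE «Drift-T» (minimal class levels of the remainder at sampled tube members, one LP each).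
Why it might fail: `|V‴(a₀)| ≈ 207 ≈ 20·V″(a₀)` — `κ_s ≈ 110·sb²`, `κ_I ≈ 230·dI²` — so the Neumann contraction pins the outer radii to `≈ 1/800`;
compressed exterior bonds at hot collar stars have larger third derivatives.
Sources: part YQ (G∞) («secant drift ≈ 21·sb»); E–Ming 2007 §2; Ortner–Theil 2013 (Lipschitz bound on `δ²E`); CRITIC-LEDGER row 1274 (d). [this file, g70] -/
def TangentDriftP (ϑc ϑ ϑp r q rsh ρ rm dm ϑ₀ Rg sb dI dB Rφ κg κI κb aHi Λ θ s : ℝ) : Prop :=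
  ∀ δ : ℝ, 0 < δ → ∀ a : ℝ, 0 < a →
    ∀ S : Set E3, IsDoorSetP aHi δ S → (∀ z : E3, Summable fun y : S => lennardJones (dist z (y : E3))) →
      (∀ p ∈ S, IsTwoShellAffineGood θ S p) →
        ∀ (L : E3 ≃L[ℝ] E3) (w : ℤ → E3), IsEquilChart a s Λ L w →
          ∀ (x₀ : E3) (K : Set E3), K ⊆ S → (∀ k ∈ K, dist k x₀ ≤ q) →
            IsTameOn ϑp S (LayeredHom (L : E3 →L[ℝ] E3) w) (coreOf S K rm) →
              IsTameOn ϑc S (LayeredHom (L : E3 →L[ℝ] E3) w) (moatIn S K r (r + rsh)) →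
                ∀ (n : ℕ) (xf : Fin n → E3), Function.Injective xf → Set.range xf = coreOf S K ρ →
                  ∀ y₀ : Fin n → E3, IsTubeReference ϑ₀ ϑ dm Rg sb dI dB (S \ coreOf S K ρ) (LayeredHom (L : E3 →L[ℝ] E3) w) xf y₀ →
                    ∀ φ₀ : (Fin n → E3) →L[ℝ] ℝ, HasFDerivAt (fun z : Fin n → E3 => clampedEnergy (S \ coreOf S K ρ) z) φ₀ y₀ →
                      ∃ H : (Fin n → E3) →L[ℝ] ((Fin n → E3) →L[ℝ] ℝ),
                        HasFDerivAt (fun z : Fin n → E3 => fderiv ℝ (fun z : Fin n → E3 => clampedEnergy (S \ coreOf S K ρ) z) z) H y₀ ∧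
                          ∀ z ∈ bondTube (S \ coreOf S K ρ) Rg sb dI dB y₀, ∀ φ : (Fin n → E3) →L[ℝ] ℝ,
                            HasFDerivAt (fun z : Fin n → E3 => clampedEnergy (S \ coreOf S K ρ) z) φ z →
                              ∀ lam : ℝ, 0 ≤ lam → lam ≤ 1 → z ∈ bondTube (S \ coreOf S K ρ) Rg (lam * sb) (lam * dI) (lam * dB) y₀ →
                                HasTubeFluxLoad (S \ coreOf S K ρ) Rg Rφ (lam * κg) (lam * κI) (lam * κb) y₀ (φ - φ₀ - H (z - y₀))

/-! ### YS-2  The scalar Neumann bootstrap and the tube's closedness in gauge (PROVED) -/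

/-- ★ **THE SCALAR BOOTSTRAP (PROVED)**: a predicate on gauges that is monotone, closed from above, true at `1`, and improved by the affine
contraction `λ ↦ m + qN·λ` (`0 ≤ qN < 1`, `m ≥ 0`) on `[0, 1]`, holds at `min(1, m/(1 − qN))` — iterate from `λ₀ = 1` (`λ_k = L + qN^k(1 − L)`,
`L = m/(1 − qN)`) and close. [this file, g70] -/
theorem bootstrap_of_contraction {P : ℝ → Prop} {m qN : ℝ} (hm : 0 ≤ m) (hq0 : 0 ≤ qN) (hq1 : qN < 1)
    (hmono : ∀ l l' : ℝ, l ≤ l' → P l → P l') (hclosed : ∀ l : ℝ, (∀ l' : ℝ, l < l' → P l') → P l) (h1 : P 1)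
    (hstep : ∀ l : ℝ, 0 ≤ l → l ≤ 1 → P l → P (m + qN * l)) : P (min 1 (m / (1 - qN))) := by
  rcases le_or_gt 1 (m / (1 - qN)) with hL | hL
  · rw [min_eq_left hL]; exact h1
  rw [min_eq_right hL.le]
  have h1q : 0 < 1 - qN := sub_pos.2 hq1
  have hL0 : 0 ≤ m / (1 - qN) := div_nonneg hm h1q.le
  have hmL : m = m / (1 - qN) * (1 - qN) := (div_mul_cancel₀ m h1q.ne').symm
  have h1L : 0 < 1 - m / (1 - qN) := sub_pos.2 hL
  have hiter : ∀ k : ℕ, P (m / (1 - qN) + qN ^ k * (1 - m / (1 - qN))) := by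
    intro k
    induction k with
    | zero =>
      have e : m / (1 - qN) + qN ^ 0 * (1 - m / (1 - qN)) = 1 := by ring
      rw [e]; exact h1
    | succ k ih =>
      have hk1 : qN ^ k * (1 - m / (1 - qN)) ≤ 1 - m / (1 - qN) := mul_le_of_le_one_left h1L.le (pow_le_one₀ hq0 hq1.le)
      have hlo : 0 ≤ m / (1 - qN) + qN ^ k * (1 - m / (1 - qN)) := add_nonneg hL0 (mul_nonneg (pow_nonneg hq0 k) h1L.le)
      have hhi : m / (1 - qN) + qN ^ k * (1 - m / (1 - qN)) ≤ 1 := by linarith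
      have h := hstep _ hlo hhi ih
      have e : m + qN * (m / (1 - qN) + qN ^ k * (1 - m / (1 - qN))) = m / (1 - qN) + qN ^ (k + 1) * (1 - m / (1 - qN)) := by
        rw [pow_succ]
        nth_rewrite 1 [hmL]
        ring
      rwa [e] at h
  refine hclosed _ fun l' hl' => ?_
  obtain ⟨k, hk⟩ := exists_pow_lt_of_lt_one (div_pos (sub_pos.2 hl') h1L) hq1
  refine hmono _ _ ?_ (hiter k)
  have h := mul_lt_mul_of_pos_right hk h1L
  rw [div_mul_cancel₀ _ h1L.ne'] at h
  linarith

variable {n : ℕ} {X : Set E3} {Rg sb dI dB : ℝ} {y₀ : Fin n → E3}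

/-- a bound that holds for every larger gauge holds at the gauge (density of `ℝ`). [this file, g70] -/
theorem le_mul_of_forall_gt {d l c : ℝ} (hc : 0 < c) (h : ∀ l' : ℝ, l < l' → d ≤ l' * c) : d ≤ l * c := by
  refine le_of_forall_gt_imp_ge_of_dense fun b hb => ?_
  have h' := h (b / c) (by rwa [lt_div_iff₀ hc])
  rwa [div_mul_cancel₀ b hc.ne'] at h'

/-- ★ **THE TUBE IS CLOSED FROM ABOVE IN GAUGE (PROVED)**: membership in every scaled tube `T(λ′ρᵒ)`, `λ′ > λ`, gives membership in `T(λρᵒ)`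
(positive radii `ρᵒ = (sb, dI, dB)`). [this file, g70] -/
theorem mem_bondTube_of_forall_gt (hsb : 0 < sb) (hdI : 0 < dI) (hdB : 0 < dB) {z : Fin n → E3} {l : ℝ}
    (h : ∀ l' : ℝ, l < l' → z ∈ bondTube X Rg (l' * sb) (l' * dI) (l' * dB) y₀) : z ∈ bondTube X Rg (l * sb) (l * dI) (l * dB) y₀ :=
  ⟨fun i j hij => le_mul_of_forall_gt hsb fun l' hl' => (h l' hl').1 i j hij,
    fun i hi => le_mul_of_forall_gt hdI fun l' hl' => (h l' hl').2.1 i hi, fun i => le_mul_of_forall_gt hdB fun l' hl' => (h l' hl').2.2 i⟩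

/-- ★★ **THE TUBE BOOTSTRAP (PROVED)**: if a member `z` of the outer tube satisfies, at every gauge `λ ∈ [0, 1]` with `z ∈ T(λρᵒ)`, the AFFINE
RESPONSE BOUND `z ∈ T(A + λ·K)` with `A ≤ m·ρᵒ` (`m ≥ 0`) and `K ≤ qN·ρᵒ` (`0 ≤ qN < 1`, `K ≥ 0`), then `z ∈ T(A + (m/(1 − qN))·K)`. [this file, g70] -/
theorem bondTube_bootstrap {z : Fin n → E3} {As AI AB Ks KI KB m qN : ℝ} (hsb : 0 < sb) (hdI : 0 < dI) (hdB : 0 < dB) (hq0 : 0 ≤ qN)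
    (hq1 : qN < 1) (hm : 0 ≤ m) (hKs : 0 ≤ Ks) (hKI : 0 ≤ KI) (hKB : 0 ≤ KB) (hAs : As ≤ m * sb) (hAI : AI ≤ m * dI) (hAB : AB ≤ m * dB)
    (hcs : Ks ≤ qN * sb) (hcI : KI ≤ qN * dI) (hcB : KB ≤ qN * dB) (hz : z ∈ bondTube X Rg sb dI dB y₀)
    (hclaim : ∀ lam : ℝ, 0 ≤ lam → lam ≤ 1 → z ∈ bondTube X Rg (lam * sb) (lam * dI) (lam * dB) y₀ →
      z ∈ bondTube X Rg (As + lam * Ks) (AI + lam * KI) (AB + lam * KB) y₀) :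
    z ∈ bondTube X Rg (As + m / (1 - qN) * Ks) (AI + m / (1 - qN) * KI) (AB + m / (1 - qN) * KB) y₀ := by
  have hfix : z ∈ bondTube X Rg (min 1 (m / (1 - qN)) * sb) (min 1 (m / (1 - qN)) * dI) (min 1 (m / (1 - qN)) * dB) y₀ := by
    refine bootstrap_of_contraction (P := fun l => z ∈ bondTube X Rg (l * sb) (l * dI) (l * dB) y₀) hm hq0 hq1
      (fun l l' hll' hl => bondTube_mono (mul_le_mul_of_nonneg_right hll' hsb.le) (mul_le_mul_of_nonneg_right hll' hdI.le)
        (mul_le_mul_of_nonneg_right hll' hdB.le) hl)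
      (fun l hl => mem_bondTube_of_forall_gt hsb hdI hdB hl) (by simpa only [one_mul] using hz) fun l hl0 hl1 hl => ?_
    have hs' := mul_le_mul_of_nonneg_left hcs hl0
    have hI' := mul_le_mul_of_nonneg_left hcI hl0
    have hB' := mul_le_mul_of_nonneg_left hcB hl0
    exact bondTube_mono (by linarith) (by linarith) (by linarith) (hclaim l hl0 hl1 hl)
  have h0 : 0 ≤ min 1 (m / (1 - qN)) := le_min zero_le_one (div_nonneg hm (sub_pos.2 hq1).le)
  have hle : min 1 (m / (1 - qN)) ≤ m / (1 - qN) := min_le_right _ _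
  exact bondTube_mono (by nlinarith [mul_le_mul_of_nonneg_right hle hKs]) (by nlinarith [mul_le_mul_of_nonneg_right hle hKI])
    (by nlinarith [mul_le_mul_of_nonneg_right hle hKB]) (hclaim _ h0 (min_le_left _ _) hfix)

/-! ### YS-3  THE JUNCTION (PROVED): (G∞) ⟸ (Gh) ∧ (Gs) ∧ Neumann arithmetic; dials; teeth -/

/-- ★★★ **THE JUNCTION (PROVED): (Gh)(H) ∧ (Gs)(κ) ∧ `0 ≤ qN < 1` ∧ `(Hκ)_k ≤ qN·ρᵒ_k` ∧ gauge weights `H_{k,c} ≤ w_c·ρᵒ_k` ⇒ (G∞)(C) with the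
NEUMANN MATRIX `C_{k,c} = H_{k,c} + (Hκ)_k·w_c/(1 − qN)`** (`ρᵒ = (sb, dI, dB) > 0`, `H, κ ≥ 0`).  For a tube member `z` with `D E(z) = φ` and
response load `φ − φ₀` of levels `M`: `H(z − y₀) = (φ − φ₀) + (−1)·(φ − φ₀ − H(z − y₀))` has levels `M + λκ` at gauge `λ` ((Gs), `.smul`,
`.add`), so (Gh) gives `z = y₀ + (z − y₀) ∈ T(HM + λ·Hκ)`; `bondTube_bootstrap` with `m = Σ_c w_c M_c`. [this file, g70] -/
theorem tubeResponseP_of_tangent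
    {ϑc ϑ ϑp r q rsh ρ rm dm ϑ₀ Rg sb dI dB Rφ HsG HsI HsB HIG HII HIB HBG HBI HBB κg κI κb qN wG wI wB aHi Λ θ s : ℝ}
    (hsb : 0 < sb) (hdI : 0 < dI) (hdB : 0 < dB) (hq0 : 0 ≤ qN) (hq1 : qN < 1)
    (h_sG : 0 ≤ HsG) (h_sI : 0 ≤ HsI) (h_sB : 0 ≤ HsB) (h_IG : 0 ≤ HIG) (h_II : 0 ≤ HII) (h_IB : 0 ≤ HIB)
    (h_BG : 0 ≤ HBG) (h_BI : 0 ≤ HBI) (h_BB : 0 ≤ HBB) (hκg : 0 ≤ κg) (hκI : 0 ≤ κI) (hκb : 0 ≤ κb)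
    (hwsG : HsG ≤ wG * sb) (hwIG : HIG ≤ wG * dI) (hwBG : HBG ≤ wG * dB) (hwsI : HsI ≤ wI * sb) (hwII : HII ≤ wI * dI) (hwBI : HBI ≤ wI * dB)
    (hwsB : HsB ≤ wB * sb) (hwIB : HIB ≤ wB * dI) (hwBB : HBB ≤ wB * dB)
    (hcs : HsG * κg + HsI * κI + HsB * κb ≤ qN * sb) (hcI : HIG * κg + HII * κI + HIB * κb ≤ qN * dI)
    (hcB : HBG * κg + HBI * κI + HBB * κb ≤ qN * dB)
    (hH : HarmonicResponseP ϑc ϑ ϑp r q rsh ρ rm dm ϑ₀ Rg sb dI dB Rφ HsG HsI HsB HIG HII HIB HBG HBI HBB aHi Λ θ s)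
    (hD : TangentDriftP ϑc ϑ ϑp r q rsh ρ rm dm ϑ₀ Rg sb dI dB Rφ κg κI κb aHi Λ θ s) :
    TubeResponseP ϑc ϑ ϑp r q rsh ρ rm dm ϑ₀ Rg sb dI dB Rφ
      (HsG + (HsG * κg + HsI * κI + HsB * κb) / (1 - qN) * wG) (HsI + (HsG * κg + HsI * κI + HsB * κb) / (1 - qN) * wI)
      (HsB + (HsG * κg + HsI * κI + HsB * κb) / (1 - qN) * wB)
      (HIG + (HIG * κg + HII * κI + HIB * κb) / (1 - qN) * wG) (HII + (HIG * κg + HII * κI + HIB * κb) / (1 - qN) * wI)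
      (HIB + (HIG * κg + HII * κI + HIB * κb) / (1 - qN) * wB)
      (HBG + (HBG * κg + HBI * κI + HBB * κb) / (1 - qN) * wG) (HBI + (HBG * κg + HBI * κI + HBB * κb) / (1 - qN) * wI)
      (HBB + (HBG * κg + HBI * κI + HBB * κb) / (1 - qN) * wB) aHi Λ θ s := by
  intro δ hδ a ha S hS hsum hgood L w hLw x₀ K hKS hKq hmild hcool n xf hxf hrange y₀ hy₀ φ₀ hφ₀ z hz φ hφ Mg MI Mb hMg hMI hMb hload
  obtain ⟨H, hHd, hdrift⟩ := hD δ hδ a ha S hS hsum hgood L w hLw x₀ K hKS hKq hmild hcool n xf hxf hrange y₀ hy₀ φ₀ hφ₀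
  have hresp := hH δ hδ a ha S hS hsum hgood L w hLw x₀ K hKS hKq hmild hcool n xf hxf hrange y₀ hy₀ H hHd
  have hwG : 0 ≤ wG := nonneg_of_mul_nonneg_left (h_sG.trans hwsG) hsb
  have hwI : 0 ≤ wI := nonneg_of_mul_nonneg_left (h_sI.trans hwsI) hsb
  have hwB : 0 ≤ wB := nonneg_of_mul_nonneg_left (h_sB.trans hwsB) hsb
  have hclaim : ∀ lam : ℝ, 0 ≤ lam → lam ≤ 1 → z ∈ bondTube (S \ coreOf S K ρ) Rg (lam * sb) (lam * dI) (lam * dB) y₀ →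
      z ∈ bondTube (S \ coreOf S K ρ) Rg (HsG * Mg + HsI * MI + HsB * Mb + lam * (HsG * κg + HsI * κI + HsB * κb))
        (HIG * Mg + HII * MI + HIB * Mb + lam * (HIG * κg + HII * κI + HIB * κb))
        (HBG * Mg + HBI * MI + HBB * Mb + lam * (HBG * κg + HBI * κI + HBB * κb)) y₀ := by
    intro lam hl0 hl1 hP
    have hd := hdrift z hz φ hφ lam hl0 hl1 hP
    have hsum' := hload.add (hd.smul (c := (-1 : ℝ)) (by rw [abs_neg, abs_one]))
    have e : (φ - φ₀) + (-1 : ℝ) • (φ - φ₀ - H (z - y₀)) = H (z - y₀) := by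
      ext v; simp only [add_apply, sub_apply, smul_apply, smul_eq_mul]; ring
    rw [e] at hsum'
    have hz' := hresp (z - y₀) (Mg + lam * κg) (MI + lam * κI) (Mb + lam * κb) (by positivity) (by positivity) (by positivity) hsum'
    have e' : y₀ + (z - y₀) = z := by abel
    rw [e'] at hz'
    exact bondTube_mono (le_of_eq (by ring)) (le_of_eq (by ring)) (le_of_eq (by ring)) hz'
  have hcore := bondTube_bootstrap (m := wG * Mg + wI * MI + wB * Mb) hsb hdI hdB hq0 hq1 (by positivity) (by positivity) (by positivity)
    (by positivity) (by nlinarith [mul_le_mul_of_nonneg_right hwsG hMg, mul_le_mul_of_nonneg_right hwsI hMI, mul_le_mul_of_nonneg_right hwsB hMb])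
    (by nlinarith [mul_le_mul_of_nonneg_right hwIG hMg, mul_le_mul_of_nonneg_right hwII hMI, mul_le_mul_of_nonneg_right hwIB hMb])
    (by nlinarith [mul_le_mul_of_nonneg_right hwBG hMg, mul_le_mul_of_nonneg_right hwBI hMI, mul_le_mul_of_nonneg_right hwBB hMb])
    hcs hcI hcB hz hclaim
  exact bondTube_mono (le_of_eq (by ring)) (le_of_eq (by ring)) (le_of_eq (by ring)) hcore

/-- **DIAL (PROVED): (G∞) is WEAKER for an entrywise larger matrix** (levels are nonnegative under its binders). [this file, g70] -/
theorem TubeResponseP.of_le {ϑc ϑ ϑp r q rsh ρ rm dm ϑ₀ Rg sb dI dB Rφ CsG CsI CsB CIG CII CIB CBG CBI CBB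
    CsG' CsI' CsB' CIG' CII' CIB' CBG' CBI' CBB' aHi Λ θ s : ℝ}
    (hsG : CsG ≤ CsG') (hsI : CsI ≤ CsI') (hsB : CsB ≤ CsB') (hIG : CIG ≤ CIG') (hII : CII ≤ CII') (hIB : CIB ≤ CIB') (hBG : CBG ≤ CBG')
    (hBI : CBI ≤ CBI') (hBB : CBB ≤ CBB') (hG : TubeResponseP ϑc ϑ ϑp r q rsh ρ rm dm ϑ₀ Rg sb dI dB Rφ CsG CsI CsB CIG CII CIB CBG CBI CBB aHi Λ θ s) :
    TubeResponseP ϑc ϑ ϑp r q rsh ρ rm dm ϑ₀ Rg sb dI dB Rφ CsG' CsI' CsB' CIG' CII' CIB' CBG' CBI' CBB' aHi Λ θ s :=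
  fun δ hδ a ha S hS hsum hgood L w hLw x₀ K hKS hKq hmild hcool n xf hxf hrange y₀ hy₀ φ₀ hφ₀ z hz φ hφ Mg MI Mb hMg hMI hMb hload =>
    bondTube_mono (by nlinarith [mul_le_mul_of_nonneg_right hsG hMg, mul_le_mul_of_nonneg_right hsI hMI, mul_le_mul_of_nonneg_right hsB hMb])
      (by nlinarith [mul_le_mul_of_nonneg_right hIG hMg, mul_le_mul_of_nonneg_right hII hMI, mul_le_mul_of_nonneg_right hIB hMb])
      (by nlinarith [mul_le_mul_of_nonneg_right hBG hMg, mul_le_mul_of_nonneg_right hBI hMI, mul_le_mul_of_nonneg_right hBB hMb])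
      (hG δ hδ a ha S hS hsum hgood L w hLw x₀ K hKS hKq hmild hcool n xf hxf hrange y₀ hy₀ φ₀ hφ₀ z hz φ hφ Mg MI Mb hMg hMI hMb hload)

/-- **DIAL (PROVED): (Gh) is WEAKER for a smaller flux radius** (fewer admissible loads). [this file, g70] -/
theorem HarmonicResponseP.of_radius_le {ϑc ϑ ϑp r q rsh ρ rm dm ϑ₀ Rg sb dI dB Rφ Rφ' HsG HsI HsB HIG HII HIB HBG HBI HBB aHi Λ θ s : ℝ}
    (hR : Rφ' ≤ Rφ) (hH : HarmonicResponseP ϑc ϑ ϑp r q rsh ρ rm dm ϑ₀ Rg sb dI dB Rφ HsG HsI HsB HIG HII HIB HBG HBI HBB aHi Λ θ s) :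
    HarmonicResponseP ϑc ϑ ϑp r q rsh ρ rm dm ϑ₀ Rg sb dI dB Rφ' HsG HsI HsB HIG HII HIB HBG HBI HBB aHi Λ θ s :=
  fun δ hδ a ha S hS hsum hgood L w hLw x₀ K hKS hKq hmild hcool n xf hxf hrange y₀ hy₀ H hHd u Mg MI Mb hMg hMI hMb hload =>
    hH δ hδ a ha S hS hsum hgood L w hLw x₀ K hKS hKq hmild hcool n xf hxf hrange y₀ hy₀ H hHd u Mg MI Mb hMg hMI hMb (hload.radius_mono hR)

/-- **DIAL (PROVED): (Gh) is WEAKER at a colder moat** (`ϑm ≤ ϑc`). [this file, g70] -/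
theorem HarmonicResponseP.of_moat_le {ϑm ϑc ϑ ϑp r q rsh ρ rm dm ϑ₀ Rg sb dI dB Rφ HsG HsI HsB HIG HII HIB HBG HBI HBB aHi Λ θ s : ℝ}
    (h : ϑm ≤ ϑc) (hH : HarmonicResponseP ϑc ϑ ϑp r q rsh ρ rm dm ϑ₀ Rg sb dI dB Rφ HsG HsI HsB HIG HII HIB HBG HBI HBB aHi Λ θ s) :
    HarmonicResponseP ϑm ϑ ϑp r q rsh ρ rm dm ϑ₀ Rg sb dI dB Rφ HsG HsI HsB HIG HII HIB HBG HBI HBB aHi Λ θ s :=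
  fun δ hδ a ha S hS hsum hgood L w hLw x₀ K hKS hKq hmild hcool =>
    hH δ hδ a ha S hS hsum hgood L w hLw x₀ K hKS hKq hmild (IsTameOn.mono h Subset.rfl hcool)

/-- **DIAL (PROVED): (Gs) is WEAKER for larger drift levels** (`κ ≤ κ'`). [this file, g70] -/
theorem TangentDriftP.of_le {ϑc ϑ ϑp r q rsh ρ rm dm ϑ₀ Rg sb dI dB Rφ κg κI κb κg' κI' κb' aHi Λ θ s : ℝ}
    (hg : κg ≤ κg') (hI : κI ≤ κI') (hB : κb ≤ κb') (hD : TangentDriftP ϑc ϑ ϑp r q rsh ρ rm dm ϑ₀ Rg sb dI dB Rφ κg κI κb aHi Λ θ s) :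
    TangentDriftP ϑc ϑ ϑp r q rsh ρ rm dm ϑ₀ Rg sb dI dB Rφ κg' κI' κb' aHi Λ θ s := by
  intro δ hδ a ha S hS hsum hgood L w hLw x₀ K hKS hKq hmild hcool n xf hxf hrange y₀ hy₀ φ₀ hφ₀
  obtain ⟨H, hHd, hdrift⟩ := hD δ hδ a ha S hS hsum hgood L w hLw x₀ K hKS hKq hmild hcool n xf hxf hrange y₀ hy₀ φ₀ hφ₀
  exact ⟨H, hHd, fun z hz φ hφ lam hl0 hl1 hP => (hdrift z hz φ hφ lam hl0 hl1 hP).mono (mul_le_mul_of_nonneg_left hg hl0)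
    (mul_le_mul_of_nonneg_left hI hl0) (mul_le_mul_of_nonneg_left hB hl0)⟩

/-- **DIAL (PROVED): (Gs) is WEAKER for a larger flux radius.** [this file, g70] -/
theorem TangentDriftP.of_radius_le {ϑc ϑ ϑp r q rsh ρ rm dm ϑ₀ Rg sb dI dB Rφ Rφ' κg κI κb aHi Λ θ s : ℝ} (hR : Rφ ≤ Rφ')
    (hD : TangentDriftP ϑc ϑ ϑp r q rsh ρ rm dm ϑ₀ Rg sb dI dB Rφ κg κI κb aHi Λ θ s) :
    TangentDriftP ϑc ϑ ϑp r q rsh ρ rm dm ϑ₀ Rg sb dI dB Rφ' κg κI κb aHi Λ θ s := by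
  intro δ hδ a ha S hS hsum hgood L w hLw x₀ K hKS hKq hmild hcool n xf hxf hrange y₀ hy₀ φ₀ hφ₀
  obtain ⟨H, hHd, hdrift⟩ := hD δ hδ a ha S hS hsum hgood L w hLw x₀ K hKS hKq hmild hcool n xf hxf hrange y₀ hy₀ φ₀ hφ₀
  exact ⟨H, hHd, fun z hz φ hφ lam hl0 hl1 hP => (hdrift z hz φ hφ lam hl0 hl1 hP).radius_mono hR⟩

/-- **DIAL (PROVED): (Gs) is WEAKER at a colder moat** (`ϑm ≤ ϑc`). [this file, g70] -/
theorem TangentDriftP.of_moat_le {ϑm ϑc ϑ ϑp r q rsh ρ rm dm ϑ₀ Rg sb dI dB Rφ κg κI κb aHi Λ θ s : ℝ} (h : ϑm ≤ ϑc)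
    (hD : TangentDriftP ϑc ϑ ϑp r q rsh ρ rm dm ϑ₀ Rg sb dI dB Rφ κg κI κb aHi Λ θ s) :
    TangentDriftP ϑm ϑ ϑp r q rsh ρ rm dm ϑ₀ Rg sb dI dB Rφ κg κI κb aHi Λ θ s :=
  fun δ hδ a ha S hS hsum hgood L w hLw x₀ K hKS hKq hmild hcool =>
    hD δ hδ a ha S hS hsum hgood L w hLw x₀ K hKS hKq hmild (IsTameOn.mono h Subset.rfl hcool)

/-- ★ **(Gh) HAS TEETH (PROVED): NO FLOPPY MODE** — under (Gh), a displacement whose harmonic load has ZERO class levels (in particular `H u = 0`)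
vanishes: the tangent stiffness is injective on the core, quantitatively in the tube's gauge. [this file, g70] -/
theorem HarmonicResponseP.eq_zero {ϑc ϑ ϑp r q rsh ρ rm dm ϑ₀ Rg sb dI dB Rφ HsG HsI HsB HIG HII HIB HBG HBI HBB aHi Λ θ s : ℝ}
    (hH : HarmonicResponseP ϑc ϑ ϑp r q rsh ρ rm dm ϑ₀ Rg sb dI dB Rφ HsG HsI HsB HIG HII HIB HBG HBI HBB aHi Λ θ s) :
    ∀ δ : ℝ, 0 < δ → ∀ a : ℝ, 0 < a →
      ∀ S : Set E3, IsDoorSetP aHi δ S → (∀ z : E3, Summable fun y : S => lennardJones (dist z (y : E3))) →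
        (∀ p ∈ S, IsTwoShellAffineGood θ S p) →
          ∀ (L : E3 ≃L[ℝ] E3) (w : ℤ → E3), IsEquilChart a s Λ L w →
            ∀ (x₀ : E3) (K : Set E3), K ⊆ S → (∀ k ∈ K, dist k x₀ ≤ q) →
              IsTameOn ϑp S (LayeredHom (L : E3 →L[ℝ] E3) w) (coreOf S K rm) →
                IsTameOn ϑc S (LayeredHom (L : E3 →L[ℝ] E3) w) (moatIn S K r (r + rsh)) →
                  ∀ (n : ℕ) (xf : Fin n → E3), Function.Injective xf → Set.range xf = coreOf S K ρ →
                    ∀ y₀ : Fin n → E3, IsTubeReference ϑ₀ ϑ dm Rg sb dI dB (S \ coreOf S K ρ) (LayeredHom (L : E3 →L[ℝ] E3) w) xf y₀ →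
                      ∀ H : (Fin n → E3) →L[ℝ] ((Fin n → E3) →L[ℝ] ℝ),
                        HasFDerivAt (fun z : Fin n → E3 => fderiv ℝ (fun z : Fin n → E3 => clampedEnergy (S \ coreOf S K ρ) z) z) H y₀ →
                          ∀ u : Fin n → E3, HasTubeFluxLoad (S \ coreOf S K ρ) Rg Rφ 0 0 0 y₀ (H u) → u = 0 := by
  intro δ hδ a ha S hS hsum hgood L w hLw x₀ K hKS hKq hmild hcool n xf hxf hrange y₀ hy₀ H hHd u hu
  have h0 := hH δ hδ a ha S hS hsum hgood L w hLw x₀ K hKS hKq hmild hcool n xf hxf hrange y₀ hy₀ H hHd u 0 0 0 le_rfl le_rfl le_rfl hu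
  funext i
  have hi := h0.2.2 i
  simp only [mul_zero, add_zero, Pi.add_apply] at hi
  simpa using dist_le_zero.1 hi

/-! ### YS-4  THE WHOLE g70 NODE (PROVED): (X2ᴸ) ⟸ (Gh) ∧ (Gs) ∧ (Rn) ∧ (Rt) ∧ arithmetic; the symbolic-`ϑ₀` docket slot -/

/-- ★★★ **THE g70 NODE AT (X2ᴸ) (PROVED; everything symbolic)**: (Gh)(H) ∧ (Gs)(κ) ∧ Neumann arithmetic (ratio `qN`, gauge weights `w`) ∧
(Rn)(n; Rf) ∧ (Rt)(t; Rf) ∧ the budget `Σ_c C_{k,c}·(n_c + t_c) ≤ (sb₁, dI₁, dB₁)_k` with `C` the Neumann matrix ⇒ (X2ᴸ)(sb₁, dI₁, dB₁) —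
`loadedTubeAprioriP_of_response` (part YQ) ∘ `tubeResponseP_of_tangent` ∘ `referenceLoadP_of_near_far` (part YR). [this file, g70] -/
theorem loadedTubeAprioriP_of_tangent_nearFar
    {ϑc ϑ ϑp r q rsh ρ rm dm ϑ₀ Rg sb dI dB Rφ HsG HsI HsB HIG HII HIB HBG HBI HBB κg κI κb qN wG wI wB ng nI nb tg tI tb Rf sb₁ dI₁ dB₁
      aHi Λ θ s : ℝ}
    (hsb : 0 < sb) (hdI : 0 < dI) (hdB : 0 < dB) (hq0 : 0 ≤ qN) (hq1 : qN < 1)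
    (h_sG : 0 ≤ HsG) (h_sI : 0 ≤ HsI) (h_sB : 0 ≤ HsB) (h_IG : 0 ≤ HIG) (h_II : 0 ≤ HII) (h_IB : 0 ≤ HIB)
    (h_BG : 0 ≤ HBG) (h_BI : 0 ≤ HBI) (h_BB : 0 ≤ HBB) (hκg : 0 ≤ κg) (hκI : 0 ≤ κI) (hκb : 0 ≤ κb)
    (hwsG : HsG ≤ wG * sb) (hwIG : HIG ≤ wG * dI) (hwBG : HBG ≤ wG * dB) (hwsI : HsI ≤ wI * sb) (hwII : HII ≤ wI * dI) (hwBI : HBI ≤ wI * dB)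
    (hwsB : HsB ≤ wB * sb) (hwIB : HIB ≤ wB * dI) (hwBB : HBB ≤ wB * dB)
    (hcs : HsG * κg + HsI * κI + HsB * κb ≤ qN * sb) (hcI : HIG * κg + HII * κI + HIB * κb ≤ qN * dI)
    (hcB : HBG * κg + HBI * κI + HBB * κb ≤ qN * dB)
    (hng : 0 ≤ ng) (hnI : 0 ≤ nI) (hnb : 0 ≤ nb) (htg : 0 ≤ tg) (htI : 0 ≤ tI) (htb : 0 ≤ tb)
    (hBs : (HsG + (HsG * κg + HsI * κI + HsB * κb) / (1 - qN) * wG) * (ng + tg) + (HsI + (HsG * κg + HsI * κI + HsB * κb) / (1 - qN) * wI) * (nI + tI)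
      + (HsB + (HsG * κg + HsI * κI + HsB * κb) / (1 - qN) * wB) * (nb + tb) ≤ sb₁)
    (hBI : (HIG + (HIG * κg + HII * κI + HIB * κb) / (1 - qN) * wG) * (ng + tg) + (HII + (HIG * κg + HII * κI + HIB * κb) / (1 - qN) * wI) * (nI + tI)
      + (HIB + (HIG * κg + HII * κI + HIB * κb) / (1 - qN) * wB) * (nb + tb) ≤ dI₁)
    (hBB : (HBG + (HBG * κg + HBI * κI + HBB * κb) / (1 - qN) * wG) * (ng + tg) + (HBI + (HBG * κg + HBI * κI + HBB * κb) / (1 - qN) * wI) * (nI + tI)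
      + (HBB + (HBG * κg + HBI * κI + HBB * κb) / (1 - qN) * wB) * (nb + tb) ≤ dB₁)
    (hH : HarmonicResponseP ϑc ϑ ϑp r q rsh ρ rm dm ϑ₀ Rg sb dI dB Rφ HsG HsI HsB HIG HII HIB HBG HBI HBB aHi Λ θ s)
    (hD : TangentDriftP ϑc ϑ ϑp r q rsh ρ rm dm ϑ₀ Rg sb dI dB Rφ κg κI κb aHi Λ θ s)
    (hn : NearReferenceLoadP ϑc ϑ ϑp r q rsh ρ rm dm ϑ₀ Rg sb dI dB Rφ ng nI nb Rf aHi Λ θ s)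
    (ht : FarReferenceLoadP ϑc ϑ ϑp r q rsh ρ rm dm ϑ₀ Rg sb dI dB Rφ tg tI tb Rf aHi Λ θ s) :
    LoadedTubeAprioriP ϑc ϑ ϑp r q rsh ρ rm dm ϑ₀ Rg sb dI dB sb₁ dI₁ dB₁ aHi Λ θ s :=
  loadedTubeAprioriP_of_response (add_nonneg hng htg) (add_nonneg hnI htI) (add_nonneg hnb htb) hBs hBI hBB
    (tubeResponseP_of_tangent hsb hdI hdB hq0 hq1 h_sG h_sI h_sB h_IG h_II h_IB h_BG h_BI h_BB hκg hκI hκb hwsG hwIG hwBG hwsI hwII hwBI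
      hwsB hwIB hwBB hcs hcI hcB hH hD)
    (referenceLoadP_of_near_far le_rfl le_rfl le_rfl hn ht)

/-- ★★ **THE SYMBOLIC-`ϑ₀` DOCKET SLOT OF THE g70 NODE (PROVED; the live instance)**: at the docket geometry `(r, q, rsh, ρ, rm) = (8, 4, 12, 16, 16)`,
`dm = 1/2`, `(aHi, Λ, θ, s) = (1, 2, 1/16, 1/50)`, far-field radius `Rf = 24`, everything else FREE: (XR) ∧ (X1)(lam > 0) ∧ (Gh) ∧ (Gs) ∧ (Rn) ∧
(Rt) ∧ the Neumann arithmetic and budget at inner radii `0 ≤ ρ₁ < ρᵒ` ⇒ the existence leaf `CoolMoatSlavedFillingP ϑm ϑf ϑp 8 4 12 16 16 (1/2) 1 2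
(1/16) (1/50)` of the tube docket (`coolMoatSlavedFillingP_tubeSlot_of_loadPath`, part YO).  Five typed leaves + arithmetic; the census tables
«GreenRow-T» (`H`), «Drift-T» (`κ`, `qN`), «RefLoad-T(near/far)» (`n`, `t`), «NearBorn-T» (`lam`) decide the dials. [this file, g70] -/
theorem tangent_nearFar_tubeSlot
    {ϑm ϑf ϑp ϑ₀ Rg sb dI dB sb₁ dI₁ dB₁ lam Rφ HsG HsI HsB HIG HII HIB HBG HBI HBB κg κI κb qN wG wI wB ng nI nb tg tI tb : ℝ}
    (hlam : 0 < lam) (hsb₁ : sb₁ < sb) (hdI₁ : dI₁ < dI) (hdB₁ : dB₁ < dB) (hsb₀ : 0 ≤ sb₁) (hdI₀ : 0 ≤ dI₁) (hdB₀ : 0 ≤ dB₁)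
    (hsb : 0 < sb) (hdI : 0 < dI) (hdB : 0 < dB) (hq0 : 0 ≤ qN) (hq1 : qN < 1)
    (h_sG : 0 ≤ HsG) (h_sI : 0 ≤ HsI) (h_sB : 0 ≤ HsB) (h_IG : 0 ≤ HIG) (h_II : 0 ≤ HII) (h_IB : 0 ≤ HIB)
    (h_BG : 0 ≤ HBG) (h_BI : 0 ≤ HBI) (h_BB : 0 ≤ HBB) (hκg : 0 ≤ κg) (hκI : 0 ≤ κI) (hκb : 0 ≤ κb)
    (hwsG : HsG ≤ wG * sb) (hwIG : HIG ≤ wG * dI) (hwBG : HBG ≤ wG * dB) (hwsI : HsI ≤ wI * sb) (hwII : HII ≤ wI * dI) (hwBI : HBI ≤ wI * dB)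
    (hwsB : HsB ≤ wB * sb) (hwIB : HIB ≤ wB * dI) (hwBB : HBB ≤ wB * dB)
    (hcs : HsG * κg + HsI * κI + HsB * κb ≤ qN * sb) (hcI : HIG * κg + HII * κI + HIB * κb ≤ qN * dI)
    (hcB : HBG * κg + HBI * κI + HBB * κb ≤ qN * dB)
    (hng : 0 ≤ ng) (hnI : 0 ≤ nI) (hnb : 0 ≤ nb) (htg : 0 ≤ tg) (htI : 0 ≤ tI) (htb : 0 ≤ tb)
    (hBs : (HsG + (HsG * κg + HsI * κI + HsB * κb) / (1 - qN) * wG) * (ng + tg) + (HsI + (HsG * κg + HsI * κI + HsB * κb) / (1 - qN) * wI) * (nI + tI)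
      + (HsB + (HsG * κg + HsI * κI + HsB * κb) / (1 - qN) * wB) * (nb + tb) ≤ sb₁)
    (hBI : (HIG + (HIG * κg + HII * κI + HIB * κb) / (1 - qN) * wG) * (ng + tg) + (HII + (HIG * κg + HII * κI + HIB * κb) / (1 - qN) * wI) * (nI + tI)
      + (HIB + (HIG * κg + HII * κI + HIB * κb) / (1 - qN) * wB) * (nb + tb) ≤ dI₁)
    (hBB : (HBG + (HBG * κg + HBI * κI + HBB * κb) / (1 - qN) * wG) * (ng + tg) + (HBI + (HBG * κg + HBI * κI + HBB * κb) / (1 - qN) * wI) * (nI + tI)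
      + (HBB + (HBG * κg + HBI * κI + HBB * κb) / (1 - qN) * wB) * (nb + tb) ≤ dB₁)
    (hR : TubeReferenceP ϑm ϑf ϑp 8 4 12 16 16 (1 / 2) ϑ₀ Rg sb dI dB 1 2 (1 / 16) (1 / 50))
    (hC : TubeConvexityP ϑm ϑf ϑp 8 4 12 16 16 (1 / 2) ϑ₀ Rg sb dI dB lam 1 2 (1 / 16) (1 / 50))
    (hH : HarmonicResponseP ϑm ϑf ϑp 8 4 12 16 16 (1 / 2) ϑ₀ Rg sb dI dB Rφ HsG HsI HsB HIG HII HIB HBG HBI HBB 1 2 (1 / 16) (1 / 50))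
    (hD : TangentDriftP ϑm ϑf ϑp 8 4 12 16 16 (1 / 2) ϑ₀ Rg sb dI dB Rφ κg κI κb 1 2 (1 / 16) (1 / 50))
    (hn : NearReferenceLoadP ϑm ϑf ϑp 8 4 12 16 16 (1 / 2) ϑ₀ Rg sb dI dB Rφ ng nI nb 24 1 2 (1 / 16) (1 / 50))
    (ht : FarReferenceLoadP ϑm ϑf ϑp 8 4 12 16 16 (1 / 2) ϑ₀ Rg sb dI dB Rφ tg tI tb 24 1 2 (1 / 16) (1 / 50)) :
    CoolMoatSlavedFillingP ϑm ϑf ϑp 8 4 12 16 16 (1 / 2) 1 2 (1 / 16) (1 / 50) :=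
  coolMoatSlavedFillingP_tubeSlot_of_loadPath hlam hsb₁ hdI₁ hdB₁ hsb₀ hdI₀ hdB₀ hR hC
    (loadedTubeAprioriP_of_tangent_nearFar hsb hdI hdB hq0 hq1 h_sG h_sI h_sB h_IG h_II h_IB h_BG h_BI h_BB hκg hκI hκb hwsG hwIG hwBG hwsI
      hwII hwBI hwsB hwIB hwBB hcs hcI hcB hng hnI hnb htg htI htb hBs hBI hBB hH hD hn ht)

end TangentResponse

end Summit.AtomisticToContinuum.Crystallization.Theorems.ChartedZeroExcessLayeredLatticeLiouville

end
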